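import Summits.HodgeConjecture.HodgeConjecture.Theses.HeckePrymWeil
import Summits.HodgeConjecture.HodgeConjecture.Theorems.HeckePrymWeilWeilTenfoldsSqrtMinus11TensorAnchorPerryPol
import Summits.HodgeConjecture.HodgeConjecture.Theorems.HeckePrymWeilWeilSixfoldsSqrtMinus7StubHyperbolicFlat
import HarnessLib.Audit

/-!
# Line `semihomogeneous-perry-design` — skeleton r3 (lead c12: s2's r1, helper conclusion unfolded; Stub 5 CLOSED by the landed p156265) for crux
`HeckePrymWeil.WeilSixfoldsSqrtMinus7` (item stmt-HodgeConjecture-1260, route route-HodgeConjecture-HeckePrymWeil)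

The SHEAF twin, at `(p, k) = (7, 3)`, of the live cycle line `semiregular-clean-lci-six` (s1 / lead c12):
same anchor (the tensor / CM fibre of Deligne's Weil family through `A`, route item `DeligneWeilFamily` =
stmt-16866 BY NAME), same shape (anchor + a transport THEOREM in print), but

* the transported OBJECT is a finite locally free, Buchweitz–Flenner(–Perry)-SEMIREGULAR sheaf `E₀` with
  POLARISED Weil-charged Chern character `ch(E₀) ∈ ℚ[θ] ⊕ ℚˣ·x₀` (`θ` the `K`-symmetrised hyperplane class)
  instead of an integral Bloch-semiregular lci 3-fold — the intended witnesses are INDEX-ENGINEERED DESIGNS of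
  simple semi-homogeneous bundles (Mukai 1978) on the CM anchor `E_K⁶`: their `Ext²` is computed by Mumford's
  index theorem, so semiregularity is FINITE ARITHMETIC over `K = ℚ(√-7)` (card `Lines/semihomogeneous-perry-design.md`
  §Hardest stub, conditions F0–F4), whereas the live line is stuck at the Bloch-semiregularity of NON-ABELIAN
  degeneracy-locus 3-folds (`H¹(N_Z)`, 27 ≤ h¹ ≤ 225, not computable on the hub — lead c12 dossier rev 3);
* the ENGINE is Perry's theorem (full semiregularity) `Perry2026_semiregularFull_remainsAlgebraic` through the
  tree's general-`n` `AnchorObject.engine_of_perry` (landed for 14642 at `n = 4`, reused by 1262 at `n = 5`),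
  here at `n = 3`, instead of the unformalised cell `BlochSemiregularSpread 6 3`.

Stubs (6; skeleton r1 — r0 had 4 and asked the bet on hyperbolic anchors too): `stub_deligneWeilFamily` (= route decl BY
NAME, item 16866, TRUE/XL), `stub_perryFull` (named claim-fact, TRUE in print), `stub_chernCharacter` (construction debt
`Nonempty StandardChernCharacterBetti`), `stub_hyperbolicFlat` (NEW, PROVABLE NOW: hyperbolicity is constant along the
family), `stub_markmanSplit` (named fact: the hyperbolic case), `stub_polarisedSemiregularBundleSix` (NEW, hardest, OPEN —
the bet, asked OFF the hyperbolic anchors only; decidable per design by finite arithmetic).  Composition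
`WeilSixfoldsSqrtMinus7_of_stubs` concludes the crux BY NAME; it is the `(7,3)` port of the landed
`TensorAnchorPerryPol.stub_perryRouteCompositionPol` (1262, v3) with a hyperbolic/non-hyperbolic case split at the anchor,
and depends on the six `sorry`s only.
-/

noncomputable section

set_option linter.dupNamespace false

open CategoryTheory AlgebraicGeometry Limits MonoidalCategory CartesianMonoidalCategory
open Literature.AlgebraicGeometry Literature.AlgebraicGeometry.Motives
  Literature.AlgebraicGeometry.HodgeTheory
open Literature.AlgebraicTopology.SingularHomology
open Summit.HodgeConjecture.HodgeConjecture.Theorems.HeckePrymWeilLine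
  (stub_upgrade stub_rationalAlongSection gcs_section_eq_of_eq owf_isoTransport
    stub_globalClassOfSection_of_leray deligneWeilFamilyDecl_iff_kAction)
open Summit.HodgeConjecture.HodgeConjecture.Theorems.HyperbolicEightfoldsSqrtMinus7.AnchorObject
  (engine_of_perry complexBetti_map_cupPowTwo cupPowTwo_mem_algebraicClasses_abelian)
open Summit.HodgeConjecture.HodgeConjecture.Theorems.WeilTenfoldsSqrtMinus11.TensorAnchorPerryPol
  (hodgeWeilSectionG_of_globalAction)

namespace Summit.HodgeConjecture.HodgeConjecture.Cruxes.WeilSixfoldsSqrtMinus7.SemihomogeneousPerryDesign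

/-! ### The six registered stubs -/

/-- **Stub 1 — REACH = DELIGNE'S WEIL FAMILY THROUGH `A`, the route item stmt-HodgeConjecture-16866 BY NAME**
(shared with the live line `semiregular-clean-lci-six` and with the 1261/1262/14642 lines): for `p ≡ 3 (4)`
prime `≥ 7`, `k ≥ 1`, a `√-p`-abelian `2k`-fold `(X, Φ)` and a non-zero rational `(k,k)` class of its strong
Weil plane — a smooth projective family over a smooth irreducible quasi-projective base, closed in `ℙᴺ × S`,
with a global `√-p` `g`, a chart `X ≅ 𝒳_{s₁}` intertwining `Φ` and `g`, abelian charts everywhere, a GLOBAL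
class through the given one, and a TENSOR-type fibre `Y ≅ 𝒳_{s₀}` (isogeny pair with `(A₁ × A₁, (x,y) ↦ (-p y, x))`;
in Deligne's proof the diagonal CM point `E_K^{2k}` of the component).  TRUE (Deligne, LNM 900, proof of
Thm 4.8); Lean-XL; carried by its own item; used here at `(7, 3)` only.
[cite: Deligne1982HodgeCycles, proof of Thm. 4.8 (pp. 47–52), clauses (b), (c)]
[cite: vanGeemen1994HodgeAV, §5.3–5.11] -/
theorem stub_deligneWeilFamily :
    Summit.HodgeConjecture.HodgeConjecture.Theses.HeckePrymWeil.DeligneWeilFamily := by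
  sorry

/-- **Stub 2 — PERRY'S THEOREM, full semiregularity** (named claim-fact of the tree
`HodgeTheory.Perry2026_semiregularFull_remainsAlgebraic`: along a smooth projective family over a smooth
complex variety, the Chern character of a finite locally free sheaf on one fibre whose FULL Buchweitz–Flenner
semiregularity map `Ext²(E,E) → ⊕_q H^{q+2}(Ω^q)` is injective, once it lifts to a continuous family of
Hodge-valued sections, is algebraic on EVERY fibre; Perry arXiv:2604.00511 Thm 1.1 (2) ⊇ Buchweitz–Flenner 2003
Thm 5.1 + Baire/CDK propagation).  TRUE in print; Lean-XL (Atiyah class on real carriers exists —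
`AtiyahClassTraceReal`, `IsISemiregular` — the relative moduli / T¹-lifting does not).  Shared verbatim with
`stub_perryFull` of 14642's skeleton and hypothesis 2 of 1262's `stub_perryRouteCompositionPol`.
[cite: Perry2026Semiregularity, Thm. 1.1 (2), Def. 2.4] [cite: BuchweitzFlenner2003, Thm. 5.1, Def. 4.1] -/
theorem stub_perryFull : Perry2026_semiregularFull_remainsAlgebraic := by
  sorry

/-- **Stub 3 — A STANDARD CHERN CHARACTER on the tree's real carriers** (construction debt
`Nonempty HodgeTheory.StandardChernCharacterBetti`: `ch : (finite locally free 𝒪-modules on a smooth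
projective ℂ-scheme) → ⊕_k H^{2k}(X(ℂ); ℂ)`, additive on short exact sequences, multiplicative, natural under
pull-back, normalised on line bundles of `ℙᴺ`; Hirzebruch / Grothendieck).  TRUE (a definition + its standard
properties); Lean-L/XL; shared with 14642 (`stub_chernCharacter`) and 1262 (hypothesis 3).
[cite: Fulton1998, §3.2 and Example 3.2.3] [cite: Hartshorne1977, Appendix A §3–4] -/
theorem stub_chernCharacter : Nonempty StandardChernCharacterBetti := by
  sorry

/-- **Stub 5 (CLOSED — landed p156265, 2026-08-17) — HYPERBOLICITY IS CONSTANT ALONG A `√-7` WEIL FAMILY.**  Along a smooth projective family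
`f : 𝒳 ⟶ S` of relative dimension `6` over a smooth irreducible quasi-projective base with a global endomorphism `g` over `S`
and a global class `Θ ∈ H²(𝒳)` with rational fibre restrictions, for two fibres with abelian charts `e : A ≅ 𝒳_s`,
`e' : A' ≅ 𝒳_{s'}` intertwining `g` with `φ`, `φ'` (`φ² = φ'² = -7`): if `(A, φ, e^*Θ_s)` is of HYPERBOLIC Weil type
(`IsHyperbolicWeilType`: a rational `φ^*`-stable `6`-frame of `H¹` isotropic for `Q_h(x,y) = h⁵ ⌣ x ⌣ y`), so is
`(A', φ', e'^*Θ_{s'})`.  PROOF SKETCH (all ingredients in the tree): `S(ℂ)` is a path-connected manifold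
(`pathConnectedSpace_complexPoints_of_smoothOfRelativeDimension`), `R¹f_*ℂ` is a local system
(`isCohomologicallyLocallyTrivialOn_univ_of_isSmoothProjectiveFamily`), parallel transport `transportFun` along a path from
`s` to `s'` is a linear isomorphism `H¹(𝒳_s) → H¹(𝒳_{s'})` that (i) preserves rationality (it is induced by the ℤ-local system),
(ii) intertwines `g_s^*` and `g_{s'}^*` (`transportFun_mem_eigenLines`-type naturality for the global `g`), (iii) is
multiplicative and carries `Θ_s` to `Θ_{s'}` (restrictions of ONE global class are a flat section), hence carries a rational
`φ^*`-stable `Q_{Θ_s}`-isotropic frame to a rational `φ'^*`-stable `Q_{Θ_{s'}}`-isotropic frame; the charts `e, e'` move frames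
between `A, A'` and the fibres.  Size M/L; the first landable named stub of this crux since p140104.  Its role: it lets Stub 4
exclude hyperbolic anchors (where the design space is smallest — kit j024611: `NS` of rank 3, 21 conditions, every design found
has a non-trivial F3 kernel) and hands the hyperbolic case to Stub 6.
[cite: VoisinHodgeII2003, §3.1.2 (local systems and flat transport)] [cite: vanGeemen1994HodgeAV, 5.2–5.4 (hyperbolic = det H ≡ (-1)ⁿ)]
[cite: Landherr1936HermitianForms] -/
theorem stub_hyperbolicFlat :
    ∀ (𝒳 S : SchemeOver ℂ) (f : 𝒳 ⟶ S) (g : 𝒳 ⟶ 𝒳), IsSmoothProjectiveFamily f (2 * 3) → IrreducibleSpace S.left → AlgebraicGeometry.Smooth S.hom → IsQuasiProjectiveOver S → g ≫ f = f → ∀ (Θ : complexBetti 𝒳 2), (∀ s : ComplexPoints S, IsRationalClass (complexBetti.map (fiberι f s) 2 Θ)) → ∀ (s s' : ComplexPoints S) (A : AbelianVariety ℂ) (φ : A ⟶ A) (e : A.X ≅ fiberOver f s) (A' : AbelianVariety ℂ) (φ' : A' ⟶ A') (e' : A'.X ≅ fiberOver f s'), A.dim = 2 * 3 → A'.dim =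 2 * 3 → φ ≫ φ = -((7 : ℤ) • 𝟙 A) → φ' ≫ φ' = -((7 : ℤ) • 𝟙 A') → (e.hom ≫ fiberι f s) ≫ g = φ.hom.hom.hom ≫ (e.hom ≫ fiberι f s) → (e'.hom ≫ fiberι f s') ≫ g = φ'.hom.hom.hom ≫ (e'.hom ≫ fiberι f s') → Literature.AlgebraicGeometry.Motives.IsHyperbolicWeilType A φ 3 (complexBetti.map e.hom 2 (complexBetti.map (fiberι f s) 2 Θ)) → Literature.AlgebraicGeometry.Motives.IsHyperbolicWeilType A' φ' 3 (complexBetti.map e'.hom 2 (complexBetti.map (fiberι f s') 2 Θ)) :=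
  -- LANDED (stub-worker of lead c12, p156265): the Theorems-namespace theorem of the same name and statement
  Summit.HodgeConjecture.HodgeConjecture.Theorems.HeckePrymWeilLine.SemihomogeneousPerryDesign.stub_hyperbolicFlat

/-- **Stub 6 — MARKMAN'S THEOREM FOR HYPERBOLIC SIXFOLDS** (named fact of the tree
`HodgeTheory.Markman2025_weilClasses_algebraic_hyperbolicSixfold`, Literature/…/WeilClassesSixfolds.lean, p85530: for every
`d ≥ 1`, the Weil classes of every complex abelian sixfold `(A, φ)`, `φ² = -d`, of HYPERBOLIC Weil type for the
`K`-symmetrised hyperplane class of some projective embedding are algebraic — Markman arXiv:2502.03415 Thm 1.5.1, the split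
component).  TRUE in print; Lean-XL; shared with r7 of line `hyperbolic-eightfold-descent` (`stub_markmanSplit`).  Used at `d = 7`
for the anchors (hence, by Stub 5, the `A`'s) that Stub 4 excludes.
[cite: Markman2025SecantWeil, Thm. 1.5.1 (with Thm. 1.4.1 and §1.2)] [cite: Markman2025SurveySecant, Thm. 1.2] -/
theorem stub_markmanSplit : Markman2025_weilClasses_algebraic_hyperbolicSixfold := by
  sorry

/-- **Stub 4 (NEW, hardest; open) — A POLARISED, WEIL-CHARGED, SEMIREGULAR VECTOR BUNDLE ON EVERY
TENSOR-TYPE `√-7` SIXFOLD** (the `(7,3)` twin of 1262's registered `stub_tensorAnchorObjectPol`).  For every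
standard Chern character `C`, every complex abelian sixfold `(Y, Ψ)`, `Ψ ≫ Ψ = -7`, admitting an isogeny pair
`(f₁, g₁, m)` towards a tensor point `(A₁ × A₁, (x, y) ↦ (-7y, x))`, `A₁` an abelian threefold (the special
fibre of Stub 1; in Deligne's construction `A₁ = E_K³`, `E_K = ℂ/𝒪_K`, so `Y ~ E_K⁶` with `K`-structure
`(ι,ι,ι,ῑ,ῑ,ῑ)` and `NS(Y)_ℚ ≅ Herm₆(K)`, rank 36), every projective embedding `ι : Y ↪ ℙᴺ` and non-zero
rational `a ∈ H²(ℙᴺ)` — giving the `K`-SYMMETRISED hyperplane class `θ = 7·ι^*a + Ψ^*ι^*a` (`Ψ^*θ = 7θ`: a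
`K`-compatible polarization class up to `ℚˣ`, the class that stays Hodge on the generic Weil fibre) — and every
non-zero rational `(3,3)` class `x` of the strong Weil plane `weilClassesOf Y Ψ 3 7`: EITHER `(Y, Ψ, θ)` is of hyperbolic Weil type (then Stubs 5–6
take over), OR on every `ℂ`-scheme `F₀ ≅ Y` there is a finite locally free `E₀`, SEMIREGULAR in the full Buchweitz–Flenner sense
(`IsISemiregular hE₀ Set.univ`), with `ch_k(E₀) = q_k·θ^k` for `k ≠ 3` and `ch₃(E₀) = q₃·θ³ + r·x`, `r ∈ ℚˣ`.
WHY PLAUSIBLY TRUE / THE WORK.  The CLASS exists in `K₀(Y) ⊗ ℚ` (`x` is algebraic on `Y`: `owf_anchorAlgebraic`,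
landed; `ch : K₀ ⊗ ℚ ≅ CH^* ⊗ ℚ ↠ algebraic classes), so the content is SEMIREGULARITY OF A REPRESENTATIVE with
polarization ballast (the Weil-PURE form `q = 0` is refuted in principle by Voisin–Lübke–Bando–Siu along the
unpolarised `K`-torus germ, census s1 §3 S-d, and is NOT claimed).  Intended witnesses (corrected by the strategist's F3-DERIVATION NO-GO, census s2 §4 N-5, card §Hardest stub):
NOT direct sums / index-0 kernels / single extensions of semi-homogeneous bundles — for those the identity classes
`u_t·id_{F_t}` sit independently in `Ext²` and the nine `h`-symmetric charge-preserving derivations `δ_f` give kernel profiles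
`(δ_f D_t)_t` of the full semiregularity map whenever `ch` is clean (hand proof; kit j024611/j024670/j024891) — but (W1)
MASSEY-RIGIDIFIED INDEX TOWERS of simple semi-homogeneous bundles `F_t` of slopes `D_t ∈ NS(E_K⁶)_ℚ = Herm₆(K)` (Mukai: exist
for every rational slope, `ch(F_t) = r(D_t)·e^{D_t}`, `Ext^*(F_t,F_t) = H^*(𝒪)`, all `Ext^*(F_s,F_t)` by Mumford's index
theorem), glued so that higher differentials (Massey products along index-1 relations between non-adjacent members, or `d₃`
through effective differences) kill all identity classes but the trace, with total `ch` solving the 915-condition moment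
system F0 (`Σ ε_t r_t e^{D_t} ∈ ℚ[θ] ⊕ ℚˣx`; real solutions with 13–25 atoms exist, K2's kit j012576/j012597/j012845); or (W2)
non-semi-homogeneous bundles with `ext² = 15` (Fourier–Mukai / Picard-type bundles of the CM sixfold).  The `Ext` calculus stays
FINITE (CM factorisation: `GL₆(𝒪_K)`-transport to diagonal slopes, elliptic theta functions) but is one level deeper than a rank.  WHY IT MIGHT FAIL.  (i) The moment system may have no `K`-RATIONAL /
integral solution with weights tied to the ranks `r(D_t)` (F1), or no Massey-rigid gluing of a solution may exist (F6); (ii) the ∀-burden: the bet is asked on EVERY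
tensor-type sixfold (incl. hyperbolic ones with `End A₁ = ℤ`, where `NS` has rank 3 and at most 19 slopes fit) and
for EVERY `K`-symmetrised very ample `θ` — designs give a cone of `(θ, x)` per anchor (lead c12 §6; reshape menu
in the card: CM-reach variant of Stub 1); (iii) no semiregular sheaf with non-zero Weil charge is known on any
NON-split Weil-type abelian variety (Markman's secant sheaves live on the split `X × X̂`, reflexive not locally
free).  NOT implied by the crux; implies it only through Stubs 1–3.  [informal size L/XL; open]
[cite: Mukai1978SemiHomogeneous, Thm. 5.8, Prop. 6.22, Thm. 7.11] [cite: BuchweitzFlenner2003, Def. 4.1, Thm. 5.1]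
[cite: Perry2026Semiregularity, Def. 2.4, Thm. 1.1 (2)] [cite: Markman2025SecantWeil, §1.2, Lemma 8.2.1]
[cite: Mumford1970AbelianVarieties, §16 (index theorem)] -/
theorem stub_polarisedSemiregularBundleSix :
    ∀ (C : StandardChernCharacterBetti) (Y : AbelianVariety ℂ) (Ψ : Y ⟶ Y) (A₁ : AbelianVariety ℂ) (f₁ : Y ⟶ A₁.prod A₁) (g₁ : A₁.prod A₁ ⟶ Y) (m : ℕ), A₁.dim = 3 → Y.dim = 6 → Ψ ≫ Ψ = -((7 : ℤ) • 𝟙 Y) → 0 < m → f₁ ≫ g₁ = m • 𝟙 Y → AlgebraicGeometry.Flat f₁.hom.hom.hom.left → g₁ ≫ Ψ = AbelianVariety.prodLift (AbelianVariety.snd A₁ A₁ ≫ (-((7 : ℤ) • 𝟙 A₁))) (AbelianVariety.fst A₁ A₁) ≫ g₁ → ∀ (ι : ProjectiveEmbedding Y.X) (a : complexBetti (projectiveSpace ι.n ℂ) 2), IsRationalClass a → a ≠ 0 → ∀ (x : complexBetti Y.X (2 * 3)), IsRationalClass x → IsOfHodgeType 6 Y.X (2 * 3) 3 3 x → x ∈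 weilClassesOf Y Ψ 3 7 → x ≠ 0 → Literature.AlgebraicGeometry.Motives.IsHyperbolicWeilType Y Ψ 3 ((7 : ℂ) • complexBetti.map ι.ι 2 a + complexBetti.map Ψ.hom.hom.hom 2 (complexBetti.map ι.ι 2 a)) ∨ ∀ (F₀ : SchemeOver ℂ) (e₀ : Y.X ≅ F₀), ∃ (E₀ : F₀.left.Modules) (hE₀ : IsFiniteLocallyFree E₀) (q : ℕ → ℚ) (r : ℚ), r ≠ 0 ∧ IsISemiregular hE₀ Set.univ ∧ (∀ k : ℕ, k ≠ 3 → C.ch F₀ E₀ k = ((q k : ℚ) : ℂ) • complexBetti.map e₀.inv (2 * k) (cupPowTwo ((7 : ℂ) • complexBetti.map ι.ι 2 a + complexBetti.map Ψ.hom.hom.hom 2 (complexBetti.map ι.ι 2 a)) k)) ∧ C.ch F₀ E₀ 3 = complexBetti.map e₀.inv (2 * 3) (((q 3 : ℚ) : ℂ) • cupPowTwo ((7 : ℂ) • complexBetti.map ι.ι 2 a + complexBetti.map Ψ.hom.hom.hom 2 (complexBetti.map ι.ι 2 a)) 3 + ((r : ℚ) : ℂ) • x) := by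
  sorry

/-! ### The composition (concludes the crux BY NAME; `(7,3)` port of `stub_perryRouteCompositionPol`) -/

/-- **`WeilSixfoldsSqrtMinus7` from the six stubs taken as HYPOTHESES** (`(7,3)` port of the landed
`TensorAnchorPerryPol.stub_perryRouteCompositionPol`; sorry-free).  Given `(A, φ)` and a non-zero rational `(3,3)` class `c`
of the typed plane: upgrade to the strong plane (`stub_upgrade`, landed); Stub 1 gives the family `f : 𝒳 → S`
through `e : A ≅ 𝒳_{s₁}` with `g`, the continuous Weil section `σ` through `c`, fibrewise Hodge
(`hodgeWeilSectionG_of_globalAction`, landed), rational along `σ` (`stub_rationalAlongSection`, landed),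
globalised to `W ∈ H⁶(𝒳)` by the PROVED Leray engine, and the anchor `e₀ : Y ≅ 𝒳_{s₀}` with `σ(s₀)` in the
strong Weil plane of `(Y, Ψ)` and `σ(s₀) ≠ 0` (identity principle); the fibres embed in one `ℙᵐ` by `ε`, a
non-zero rational `a ∈ H²(ℙᵐ)` exists and `Θ_K := 7·ε^*a + g^*ε^*a` is a GLOBAL class with rational `(1,1)`
fibre restrictions; at `s₀` it is `e₀`-transported to the bet's `θ`; at a HYPERBOLIC anchor Stub 5 makes `A` hyperbolic and Stub 6 concludes; otherwise Stubs 3–4 give `E₀` on `𝒳_{s₀}`;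
`engine_of_perry` (Stub 2) makes `q₃·Θ_K|_{s₁}³ + r·W|_{s₁}` algebraic; `Θ_K|_{s₁}³` is algebraic on the abelian
`A ≅ 𝒳_{s₁}` (Lefschetz `(1,1)`, discharged, + Kleiman); hence `r·e^{-1*}c`, hence `c`, is algebraic
(`IsoInvariance`, proved).  CONDITIONAL: nothing is asserted beyond the four hypotheses.
[cite: Deligne1982HodgeCycles, proof of Thm. 4.8 (pp. 47–52) with Prop. 4.4]
[cite: Perry2026Semiregularity, Thm. 1.1 (2)] [cite: VoisinHodgeII2003, Thm. 4.18 and §9.2.4 Prop. 9.20] -/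
theorem weilSixfoldsSqrtMinus7_of_hypotheses :
    Summit.HodgeConjecture.HodgeConjecture.Theses.HeckePrymWeil.DeligneWeilFamily →
    Perry2026_semiregularFull_remainsAlgebraic → Nonempty StandardChernCharacterBetti →
    (∀ (𝒳 S : SchemeOver ℂ) (f : 𝒳 ⟶ S) (g : 𝒳 ⟶ 𝒳), IsSmoothProjectiveFamily f (2 * 3) → IrreducibleSpace S.left → AlgebraicGeometry.Smooth S.hom → IsQuasiProjectiveOver S → g ≫ f = f → ∀ (Θ : complexBetti 𝒳 2), (∀ s : ComplexPoints S, IsRationalClass (complexBetti.map (fiberι f s) 2 Θ)) → ∀ (s s' : ComplexPoints S) (A : AbelianVariety ℂ) (φ : A ⟶ A) (e : A.X ≅ fiberOver f s) (A' : AbelianVariety ℂ) (φ' : A' ⟶ A') (e' : A'.X ≅ fiberOver f s'), A.dim = 2 * 3 → A'.dim = 2 * 3 → φ ≫ φ = -((7 : ℤ) • 𝟙 A) → φ' ≫ φ' = -((7 : ℤ) • 𝟙 A') → (e.hom ≫ fiberι f s) ≫ g = φ.hom.hom.hom ≫ (e.hom ≫ fiberι f s) → (e'.hom ≫ fiberι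 f s') ≫ g = φ'.hom.hom.hom ≫ (e'.hom ≫ fiberι f s') → Literature.AlgebraicGeometry.Motives.IsHyperbolicWeilType A φ 3 (complexBetti.map e.hom 2 (complexBetti.map (fiberι f s) 2 Θ)) → Literature.AlgebraicGeometry.Motives.IsHyperbolicWeilType A' φ' 3 (complexBetti.map e'.hom 2 (complexBetti.map (fiberι f s') 2 Θ))) →
    Markman2025_weilClasses_algebraic_hyperbolicSixfold →
    (∀ (C : StandardChernCharacterBetti) (Y : AbelianVariety ℂ) (Ψ : Y ⟶ Y) (A₁ : AbelianVariety ℂ) (f₁ : Y ⟶ A₁.prod A₁) (g₁ : A₁.prod A₁ ⟶ Y) (m : ℕ), A₁.dim = 3 → Y.dim = 6 → Ψ ≫ Ψ = -((7 : ℤ) • 𝟙 Y) → 0 < m → f₁ ≫ g₁ = m • 𝟙 Y → AlgebraicGeometry.Flat f₁.hom.hom.hom.left → g₁ ≫ Ψ = AbelianVariety.prodLift (AbelianVariety.snd A₁ A₁ ≫ (-((7 : ℤ) • 𝟙 A₁))) (AbelianVariety.fst A₁ A₁) ≫ g₁ → ∀ (ι : ProjectiveEmbedding Y.X) (a : complexBetti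 (projectiveSpace ι.n ℂ) 2), IsRationalClass a → a ≠ 0 → ∀ (x : complexBetti Y.X (2 * 3)), IsRationalClass x → IsOfHodgeType 6 Y.X (2 * 3) 3 3 x → x ∈ weilClassesOf Y Ψ 3 7 → x ≠ 0 → Literature.AlgebraicGeometry.Motives.IsHyperbolicWeilType Y Ψ 3 ((7 : ℂ) • complexBetti.map ι.ι 2 a + complexBetti.map Ψ.hom.hom.hom 2 (complexBetti.map ι.ι 2 a)) ∨ ∀ (F₀ : SchemeOver ℂ) (e₀ : Y.X ≅ F₀), ∃ (E₀ : F₀.left.Modules) (hE₀ : IsFiniteLocallyFree E₀) (q : ℕ → ℚ) (r : ℚ), r ≠ 0 ∧ IsISemiregular hE₀ Set.univ ∧ (∀ k : ℕ, k ≠ 3 → C.ch F₀ E₀ k = ((q k : ℚ) : ℂ) • complexBetti.map e₀.inv (2 * k) (cupPowTwo ((7 : ℂ) • complexBetti.map ι.ι 2 a + complexBetti.map Ψ.hom.hom.hom 2 (complexBetti.map ι.ι 2 a)) k)) ∧ C.ch F₀ E₀ 3 = complexBetti.map e₀.inv (2 * 3) (((q 3 : ℚ) : ℂ) • cupPowTwo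 ((7 : ℂ) • complexBetti.map ι.ι 2 a + complexBetti.map Ψ.hom.hom.hom 2 (complexBetti.map ι.ι 2 a)) 3 + ((r : ℚ) : ℂ) • x)) →
    -- the crux `HeckePrymWeil.WeilSixfoldsSqrtMinus7`, UNFOLDED (so that exactly one theorem of this file,
    -- `WeilSixfoldsSqrtMinus7_of_stubs`, has the route decl as its literal type for the skeleton audit; lead c12)
    ∀ (A : AbelianVariety ℂ) (φ : A ⟶ A), A.dim = 6 → φ ≫ φ = -((7 : ℤ) • 𝟙 A) →
      ∀ c : complexBetti A.X 6, IsRationalClass c → IsOfHodgeType 6 A.X 6 3 3 c →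
        c ∈ Module.End.eigenspace (complexBetti.map (𝟙 A + φ).hom.hom.hom 6).hom
              ((1 + Complex.I * (Real.sqrt (7 : ℝ) : ℂ)) ^ 6) ⊔
            Module.End.eigenspace (complexBetti.map (𝟙 A + φ).hom.hom.hom 6).hom
              ((1 - Complex.I * (Real.sqrt (7 : ℝ) : ℂ)) ^ 6) →
        c ∈ algebraicClasses A.X 3 := by
  intro hF hP hC hFlat hM hB A φ hA hφ c hr hH hW
  by_cases hc : c = 0
  · rw [hc]
    exact Submodule.zero_mem _
  -- casts: the packages are stated for a variable prime `p`, here `p = 7`, at degree `2 * 3`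
  have hφ' : φ ≫ φ = -(((7 : ℕ) : ℤ) • 𝟙 A) := by exact_mod_cast hφ
  have hA' : A.dim = 2 * 3 := hA
  -- typing upgrade (landed): the single-operator plane lies in the strong Weil plane
  have hcW : c ∈ weilClassesOf A φ 3 7 := by
    refine stub_upgrade 7 (by norm_num) (by norm_num) (by norm_num) 3 A φ hA' hφ' ?_
    exact_mod_cast hW
  -- the route item, as the abelian scheme with `K`-action (landed equivalences), with the action KEPT
  have hK : deligne1982_weilFamily_kAction := deligneWeilFamilyDecl_iff_kAction.mp hF
  have hG : deligne1982_weilFamily_globalAction := deligne1982_weilFamily_globalAction_of_kAction hK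
  obtain ⟨𝒳, S, f, g, s₁, s₀, e, σ, hfam, hemb, hirr, hsm, hSqp, hg, hfib, he, hσc, hpt, hHσ, hs₁, Y, Ψ,
    e₀, x, ⟨A₁, f₁, g₁, m, hA₁, hY, hΨ, hm, hfg, hf₁, hg₁⟩, he₀, hs₀, hx⟩ :=
    hodgeWeilSectionG_of_globalAction hG 7 (by norm_num) (by norm_num) (by norm_num) 3 (by norm_num) A φ hA'
      hφ' c hcW hc hr hH
  -- rationality along the section (landed)
  have hrat₁ : IsRationalClass (σ s₁).cls := by
    rw [hs₁]; exact hr.map _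
  have hratσ : ∀ s, IsRationalClass (σ s).cls :=
    stub_rationalAlongSection f (2 * 3) (2 * 3) hfam hsm hSqp hirr σ hσc hpt s₁ hrat₁
  have hratx : IsRationalClass x := by
    have h := hratσ s₀
    rwa [hs₀] at h
  have hHx : IsOfHodgeType 6 (fiberOver f s₀) (2 * 3) 3 3 x := by
    have h := hHσ s₀
    rw [hs₀] at h
    exact h
  -- the base is a connected manifold; `R• f_* ℂ` is a local system on it
  haveI := hsm
  haveI := hirr
  haveI : LocallyOfFiniteType S.hom := hSqp.locallyOfFiniteType
  haveI : ConnectedSpace (ComplexPoints S) :=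
    (ComplexPoints.connectedSpace_iff_holds S).2 inferInstance
  obtain ⟨dS, hdS⟩ := exists_smoothOfRelativeDimension_of_connectedSpace_complexPoints S
  haveI := hdS
  haveI := pathConnectedSpace_complexPoints_of_smoothOfRelativeDimension S dS
  have hU := isCohomologicallyLocallyTrivialOn_univ_of_isSmoothProjectiveFamily f dS hfam hSqp
  -- `x ≠ 0`: a continuous section vanishing at `s₀` vanishes identically (identity principle, landed)
  have hx0 : x ≠ 0 := by
    intro hx0
    have hzero : σ s₀ = globalSection f (2 * 3) 0 s₀ := by
      rw [hs₀, hx0]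
      show (⟨s₀, 0⟩ : FiberClass f (2 * 3)) = ⟨s₀, _⟩
      rw [map_zero]
    have hall := gcs_section_eq_of_eq f (2 * 3) hU hσc hpt (continuous_globalSection f _ 0)
      (fun _ => rfl) hzero s₁
    rw [hs₁] at hall
    have hc' : complexBetti.map e.inv (2 * 3) c = 0 := by
      have h2 := ((FiberClass.clsAt_eq_iff _ rfl _).2 hall.symm).symm
      rw [h2]
      show complexBetti.map (fiberι f s₁) (2 * 3) 0 = 0
      rw [map_zero]
    apply hc
    have h3 := congrArg (complexBetti.map e.hom (2 * 3)) hc'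
    rwa [map_zero, ← CategoryTheory.comp_apply, ← complexBetti.map_comp, Iso.hom_inv_id,
      complexBetti.map_id, CategoryTheory.id_apply] at h3
  -- the PROVED Leray engine: `σ` is the restriction of a global class `W`
  obtain ⟨W, hWσ⟩ := stub_globalClassOfSection_of_leray deligne1968_invariantClass_fromTotalSpace_holds f (2 * 3)
    (2 * 3) hfam hemb hsm hSqp hirr σ hσc hpt
  have hcls : ∀ (s : ComplexPoints S) (y : complexBetti (fiberOver f s) (2 * 3)),
      σ s = ⟨s, y⟩ → complexBetti.map (fiberι f s) (2 * 3) W = y := by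
    intro s y hy
    have h := (hWσ s).symm.trans hy
    simp only [globalSection, FiberClass.mk.injEq, heq_eq_eq, true_and] at h
    exact h
  have hW₁ : complexBetti.map (fiberι f s₁) (2 * 3) W = complexBetti.map e.inv (2 * 3) c := hcls s₁ _ hs₁
  have hW₀ : complexBetti.map (fiberι f s₀) (2 * 3) W = x := hcls s₀ x hs₀
  have hWrat : ∀ s, IsRationalClass (complexBetti.map (fiberι f s) (2 * 3) W) := by
    intro s
    have h := hratσ s
    rw [hWσ s] at h
    exact h
  have hWH : ∀ s, IsOfHodgeType (2 * 3) (fiberOver f s) (2 * 3) 3 3 (complexBetti.map (fiberι f s) (2 * 3) W) := by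
    intro s
    have h := hHσ s
    rw [hWσ s] at h
    exact h
  -- the fibre maps of `g`
  have hgf' := fun t ↦ exists_fiberHom_comp_fiberι f g hg t
  choose gf hgf using hgf'
  -- all fibres embed in ONE projective space `ℙᵐ`, `m ≥ 6`
  obtain ⟨mm, ε, hε⟩ := exists_forall_isClosedImmersion_fiberι_comp f hfam hemb hSqp
  have hPm : IsSmoothProjective mm (projectiveSpace mm ℂ) := isSmoothProjective_projectiveSpace' mm
  have hmm : 1 ≤ mm := by
    haveI := hε s₀
    obtain ⟨B⟩ := (nonempty_hodgeModel_holds (n := 2 * 3) (X := fiberOver f s₀)).nonempty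
      (hfam.isSmoothProjective s₀)
    obtain ⟨Bm⟩ := (nonempty_hodgeModel_holds (n := mm) (X := projectiveSpace mm ℂ)).nonempty hPm
    have h := dim_le_of_isClosedImmersion_projectiveSpace (hfam.isSmoothProjective s₀) (fiberι f s₀ ≫ ε) B Bm
    omega
  obtain ⟨a, ha, ha0⟩ := exists_isRationalClass_ne_zero_projectiveSpace hmm
  have ha11 : IsOfHodgeType mm (projectiveSpace mm ℂ) (2 * 1) 1 1 a :=
    isOfHodgeType_of_mem_algebraicClasses_of_isSmoothProjective hPm 1
      (by rw [algebraicClasses_projectiveSpace_eq_top]; exact Submodule.mem_top)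
  -- the GLOBAL `K`-symmetrised hyperplane class `Θ_K = 7·ε^*a + g^*ε^*a` and its fibre restrictions
  set Θ : complexBetti 𝒳 2 := complexBetti.map ε 2 a with hΘdef
  set ΘK : complexBetti 𝒳 2 := (7 : ℂ) • Θ + complexBetti.map g 2 Θ with hΘKdef
  -- `θ_s := ι_s^* Θ = (ι_s ≫ ε)^* a`
  have hθs : ∀ s, complexBetti.map (fiberι f s) 2 Θ = complexBetti.map (fiberι f s ≫ ε) 2 a := by
    intro s
    rw [hΘdef, complexBetti.map_comp, ModuleCat.comp_apply]
  have hΘKs : ∀ s, complexBetti.map (fiberι f s) 2 ΘK =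
      (7 : ℂ) • complexBetti.map (fiberι f s) 2 Θ +
        complexBetti.map (gf s) 2 (complexBetti.map (fiberι f s) 2 Θ) := by
    intro s
    rw [hΘKdef, map_add, map_smul, ← ModuleCat.comp_apply (complexBetti.map g 2),
      ← complexBetti.map_comp, ← hgf s, complexBetti.map_comp, ModuleCat.comp_apply]
  -- `Θ_K|_{𝒳_s}` is rational of type `(1,1)` on every fibre
  have hΘKfib : ∀ s, IsRationalClass (complexBetti.map (fiberι f s) 2 ΘK) ∧
      IsOfHodgeType (2 * 3) (fiberOver f s) 2 1 1 (complexBetti.map (fiberι f s) 2 ΘK) := by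
    intro s
    have hsp := hfam.isSmoothProjective s
    have hrat' : IsRationalClass (complexBetti.map (fiberι f s) 2 Θ) := by
      rw [hθs s]; exact ha.map _
    have h7' : IsOfHodgeType (2 * 3) (fiberOver f s) 2 1 1 (complexBetti.map (fiberι f s) 2 Θ) := by
      rw [hθs s]; exact ha11.map_of_isSmoothProjective hsp hPm _
    rw [hΘKs s]
    refine ⟨?_, (h7'.smul _).add hsp (h7'.map_of_isSmoothProjective hsp hsp _)⟩
    have h7 : ((7 : ℚ) : ℂ) • complexBetti.map (fiberι f s) 2 Θ = (7 : ℂ) • complexBetti.map (fiberι f s) 2 Θ := by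
      norm_num
    rw [← h7]
    exact (hrat'.smul 7).add (hrat'.map _)
  -- the anchor's embedding `Y ≅ 𝒳_{s₀} ↪ ℙᵐ` and the bet's `K`-symmetrised class `θ` through `e₀`
  haveI : IsIso e₀.hom.left :=
    ⟨e₀.inv.left, by rw [← Over.comp_left, e₀.hom_inv_id, Over.id_left],
      by rw [← Over.comp_left, e₀.inv_hom_id, Over.id_left]⟩
  haveI := hε s₀
  haveI : IsClosedImmersion (e₀.hom ≫ (fiberι f s₀ ≫ ε)).left := by
    rw [Over.comp_left]
    infer_instance
  let ιY : ProjectiveEmbedding Y.X := ⟨mm, e₀.hom ≫ (fiberι f s₀ ≫ ε), inferInstance⟩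
  have he₀' : e₀.hom ≫ gf s₀ = Ψ.hom.hom.hom ≫ e₀.hom :=
    hom_comp_fiberHom_eq_of_comp_fiberι f g (hgf s₀) e₀ Ψ.hom.hom.hom he₀
  have hιa : complexBetti.map ιY.ι 2 a = complexBetti.map e₀.hom 2 (complexBetti.map (fiberι f s₀) 2 Θ) := by
    show complexBetti.map (e₀.hom ≫ (fiberι f s₀ ≫ ε)) 2 a = _
    rw [complexBetti.map_comp, ModuleCat.comp_apply, hθs s₀]
  have hθY : complexBetti.map e₀.inv 2
      ((7 : ℂ) • complexBetti.map ιY.ι 2 a + complexBetti.map Ψ.hom.hom.hom 2 (complexBetti.map ιY.ι 2 a)) =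
      complexBetti.map (fiberι f s₀) 2 ΘK := by
    rw [hιa, map_add, map_smul, e₀.complexBetti_map_inv_map_hom, hΘKs s₀]
    congr 1
    rw [← ModuleCat.comp_apply (complexBetti.map e₀.hom 2), ← complexBetti.map_comp,
      ← ModuleCat.comp_apply (complexBetti.map (Ψ.hom.hom.hom ≫ e₀.hom) 2), ← complexBetti.map_comp,
      ← he₀', e₀.inv_hom_id_assoc]
  -- the Weil class read on `Y`
  have hxY0 : complexBetti.map e₀.hom (2 * 3) x ≠ 0 := by
    intro h0
    apply hx0
    have h3 := congrArg (complexBetti.map e₀.inv (2 * 3)) h0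
    rwa [map_zero, e₀.complexBetti_map_inv_map_hom] at h3
  have hxYH : IsOfHodgeType 6 Y.X (2 * 3) 3 3 (complexBetti.map e₀.hom (2 * 3) x) := hHx.map_of_iso e₀
  -- STUB C: a standard Chern character; STUB B: the polarised semiregular object on `𝒳_{s₀} ≅ Y`
  obtain ⟨C⟩ := hC
  -- `A` is smooth projective of dimension `6`
  have hAsp : IsSmoothProjective (2 * 3) A.X := by
    have h := AbelianVariety.isSmoothProjective_holds (A := A)
    rw [AbelianVariety.isSmoothProjective, hA'] at h
    exact h
  rcases hB C Y Ψ A₁ f₁ g₁ m hA₁ hY (by exact_mod_cast hΨ) hm hfg hf₁ (by exact_mod_cast hg₁) ιY a ha ha0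
      (complexBetti.map e₀.hom (2 * 3) x) (hratx.map _) hxYH hx hxY0 with hhypY | hBet
  · /- HYPERBOLIC ANCHOR: hyperbolicity is flat (Stub 5), so `A` is hyperbolic for the `K`-symmetrised hyperplane class of
       the embedding `e ≫ ι_{s₁} ≫ ε`, and Markman's theorem (Stub 6) gives the claim directly. -/
    -- the anchor's class `θ_Y` is the `e₀`-transport of `Θ_K|_{s₀}`
    have hθY' : complexBetti.map e₀.hom 2 (complexBetti.map (fiberι f s₀) 2 ΘK) =
        (7 : ℂ) • complexBetti.map ιY.ι 2 a + complexBetti.map Ψ.hom.hom.hom 2 (complexBetti.map ιY.ι 2 a) := by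
      rw [← hθY, ← CategoryTheory.comp_apply, ← complexBetti.map_comp, Iso.hom_inv_id, complexBetti.map_id,
        CategoryTheory.id_apply]
    rw [← hθY'] at hhypY
    -- the embedding of `A` through its chart and the `K`-symmetrised class at `s₁`
    haveI : IsIso e.hom.left :=
      ⟨e.inv.left, by rw [← Over.comp_left, e.hom_inv_id, Over.id_left],
        by rw [← Over.comp_left, e.inv_hom_id, Over.id_left]⟩
    haveI := hε s₁
    haveI : IsClosedImmersion (e.hom ≫ (fiberι f s₁ ≫ ε)).left := by
      rw [Over.comp_left]
      infer_instance
    let ιA : ProjectiveEmbedding A.X := ⟨mm, e.hom ≫ (fiberι f s₁ ≫ ε), inferInstance⟩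
    have he' : e.hom ≫ gf s₁ = φ.hom.hom.hom ≫ e.hom :=
      hom_comp_fiberHom_eq_of_comp_fiberι f g (hgf s₁) e φ.hom.hom.hom he
    have hιAa : complexBetti.map ιA.ι 2 a = complexBetti.map e.hom 2 (complexBetti.map (fiberι f s₁) 2 Θ) := by
      show complexBetti.map (e.hom ≫ (fiberι f s₁ ≫ ε)) 2 a = _
      rw [complexBetti.map_comp, ModuleCat.comp_apply, hθs s₁]
    have hθA : complexBetti.map e.inv 2
        ((7 : ℂ) • complexBetti.map ιA.ι 2 a + complexBetti.map φ.hom.hom.hom 2 (complexBetti.map ιA.ι 2 a)) =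
        complexBetti.map (fiberι f s₁) 2 ΘK := by
      rw [hιAa, map_add, map_smul, e.complexBetti_map_inv_map_hom, hΘKs s₁]
      congr 1
      rw [← ModuleCat.comp_apply (complexBetti.map e.hom 2), ← complexBetti.map_comp,
        ← ModuleCat.comp_apply (complexBetti.map (φ.hom.hom.hom ≫ e.hom) 2), ← complexBetti.map_comp,
        ← he', e.inv_hom_id_assoc]
    have hθA' : complexBetti.map e.hom 2 (complexBetti.map (fiberι f s₁) 2 ΘK) =
        (7 : ℂ) • complexBetti.map ιA.ι 2 a + complexBetti.map φ.hom.hom.hom 2 (complexBetti.map ιA.ι 2 a) := by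
      rw [← hθA, ← CategoryTheory.comp_apply, ← complexBetti.map_comp, Iso.hom_inv_id, complexBetti.map_id,
        CategoryTheory.id_apply]
    -- Stub 5: transport hyperbolicity from the anchor `s₀` to `s₁`
    have hhypA := hFlat 𝒳 S f g hfam hirr hsm hSqp hg ΘK (fun s => (hΘKfib s).1) s₀ s₁ Y Ψ e₀ A φ e hY hA'
      (by exact_mod_cast hΨ) hφ he₀ he hhypY
    rw [hθA'] at hhypA
    -- Stub 6: Markman at `d = 7`
    have hφn : φ ≫ φ = -((7 : ℕ) • 𝟙 A) := by rw [hφ', natCast_zsmul]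
    exact hM 7 (by norm_num) A φ hA' hAsp hφn ιA a ha ha0 hhypA c hr hH hcW
  obtain ⟨E₀, hE₀, q, r, hr0, hsr, hEk, hE3⟩ := hBet (fiberOver f s₀) e₀
  have hrC : ((r : ℚ) : ℂ) ≠ 0 := by exact_mod_cast hr0
  -- the Chern character of `E₀` in terms of the GLOBAL classes `Θ_K`, `r • W`
  have hk : ∀ k : ℕ, k ≠ 3 →
      C.ch (fiberOver f s₀) E₀ k = ((q k : ℚ) : ℂ) • cupPowTwo (complexBetti.map (fiberι f s₀) 2 ΘK) k := by
    intro k hk3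
    rw [hEk k hk3, complexBetti_map_cupPowTwo, hθY]
  have hWrat' : ∀ s, IsRationalClass (complexBetti.map (fiberι f s) (2 * 3) (((r : ℚ) : ℂ) • W)) := by
    intro s
    rw [map_smul]
    exact (hWrat s).smul r
  have hWH' : ∀ s, IsOfHodgeType (2 * 3) (fiberOver f s) (2 * 3) 3 3
      (complexBetti.map (fiberι f s) (2 * 3) (((r : ℚ) : ℂ) • W)) := by
    intro s
    rw [map_smul]
    exact (hWH s).smul _
  have hn : C.ch (fiberOver f s₀) E₀ 3 =
      ((q 3 : ℚ) : ℂ) • cupPowTwo (complexBetti.map (fiberι f s₀) 2 ΘK) 3 +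
        complexBetti.map (fiberι f s₀) (2 * 3) (((r : ℚ) : ℂ) • W) := by
    rw [hE3, map_add, map_smul, map_smul, complexBetti_map_cupPowTwo, hθY, e₀.complexBetti_map_inv_map_hom,
      map_smul, hW₀]
  -- STUB P through the engine: `q₃·Θ_K|_{s₁}³ + r·W|_{s₁}` is algebraic on `𝒳_{s₁}`
  have halg := engine_of_perry hP 3 f hfam hirr hsm hSqp ΘK hΘKfib (((r : ℚ) : ℂ) • W) hWrat' hWH' s₀
    C.toChernCharacterBetti E₀ hE₀ hsr q hk hn s₁
  -- `Θ_K|_{s₁}³` is algebraic on `𝒳_{s₁}`: Lefschetz (1,1) (discharged) + Kleiman on the abelian `A ≅ 𝒳_{s₁}`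
  have hh₁rat : IsRationalClass (complexBetti.map e.hom 2 (complexBetti.map (fiberι f s₁) 2 ΘK)) :=
    (hΘKfib s₁).1.map _
  have hh₁H : IsOfHodgeType (2 * 3) A.X 2 1 1 (complexBetti.map e.hom 2 (complexBetti.map (fiberι f s₁) 2 ΘK)) :=
    (hΘKfib s₁).2.map_of_iso e
  have hh₁alg : complexBetti.map e.hom 2 (complexBetti.map (fiberι f s₁) 2 ΘK) ∈ algebraicClasses A.X 1 :=
    lefschetzOneOne_rational_holds hAsp _ hh₁rat hh₁H
  have hh₁3 : complexBetti.map e.hom (2 * 3) (cupPowTwo (complexBetti.map (fiberι f s₁) 2 ΘK) 3) ∈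
      algebraicClasses A.X 3 := by
    rw [complexBetti_map_cupPowTwo]
    exact cupPowTwo_mem_algebraicClasses_abelian A hh₁alg 2
  have hΘ3 : cupPowTwo (complexBetti.map (fiberι f s₁) 2 ΘK) 3 ∈ algebraicClasses (fiberOver f s₁) 3 :=
    owf_isoTransport _ A e 3 _ hh₁3
  -- hence `r • W_{s₁} = r • e^{-1*} c`, and so `e^{-1*} c` (`r ≠ 0`), is algebraic on `𝒳_{s₁}`
  have hrW₁alg : ((r : ℚ) : ℂ) • complexBetti.map e.inv (2 * 3) c ∈ algebraicClasses (fiberOver f s₁) 3 := by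
    rw [← hW₁, ← map_smul]
    have h := Submodule.sub_mem _ halg (Submodule.smul_mem _ (((q 3 : ℚ) : ℂ)) hΘ3)
    rwa [add_sub_cancel_left] at h
  have h1 : complexBetti.map e.inv (2 * 3) c ∈ algebraicClasses (fiberOver f s₁) 3 :=
    (Submodule.smul_mem_iff _ hrC).mp hrW₁alg
  -- back along `e : A ≅ 𝒳_{s₁}` (the route's proved `IsoInvariance`)
  have key := Theorems.isoInvariance_proof e 3 _ h1
  rw [← CategoryTheory.comp_apply, ← complexBetti.map_comp, Iso.hom_inv_id, complexBetti.map_id] at key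
  exact key

/-- **`WeilSixfoldsSqrtMinus7` from the six stubs** — the skeleton theorem (concludes the crux BY NAME; depends on
the six stubs' `sorry`s and on nothing else): `weilSixfoldsSqrtMinus7_of_hypotheses` applied to the stubs.
[cite: Perry2026Semiregularity, Thm. 1.1 (2)] [cite: Deligne1982HodgeCycles, proof of Thm. 4.8] -/
theorem WeilSixfoldsSqrtMinus7_of_stubs :
    Summit.HodgeConjecture.HodgeConjecture.Theses.HeckePrymWeil.WeilSixfoldsSqrtMinus7 :=
  weilSixfoldsSqrtMinus7_of_hypotheses stub_deligneWeilFamily stub_perryFull stub_chernCharacter stub_hyperbolicFlat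
    stub_markmanSplit stub_polarisedSemiregularBundleSix

end Summit.HodgeConjecture.HodgeConjecture.Cruxes.WeilSixfoldsSqrtMinus7.SemihomogeneousPerryDesign

end
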